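import Summits.BirchSwinnertonDyer.BirchSwinnertonDyer.Theorems.GoldfeldGoodTwistsAllTwistsCells
import Summits.BirchSwinnertonDyer.Rank1Residual.P2.CMRankOneAtTwoHeegnerIndex
import Summits.BirchSwinnertonDyer.Rank1Residual.X12.InertCoreEveryCurve
import Summits.BirchSwinnertonDyer.Rank1Residual.X12.CMTwoTorsion
import Literature.NumberTheory.EllipticCurves.BurungaleCastellaSkinnerTian2022.CMPConverse
import Literature.NumberTheory.EllipticCurves.BSDSelmerCMPConverseMaximalOrderProofs
import Literature.NumberTheory.EllipticCurves.ComplexMultiplicationLFunctionIsogenyHoldsProofs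
import HarnessLib

set_option linter.dupNamespace false -- namespace `…BirchSwinnertonDyer.BirchSwinnertonDyer…` is the cell's (D-0017 nested layout)
set_option autoImplicit false

/-!
# Route `GoldfeldAllTwistsTwoConverse`, crux twin″ `BSDTwoCMSevenAdditiveRankOne` (item 19140): ISOGENY REDUCTION
# (Cassels) of the two HALVES of line «heegner-halves» to the one `j`-invariant `−3375`

Seat `leafhand-bsd-goldfeldalltwistst-2-g0` (prover, explicit unit), `--supports stmt-BirchSwinnertonDyer-19140`; third of
three bookkeeping files (after `…TwinHeegnerHalvesPlacement` p793889 and `…TwinHeegnerHalvesNondegeneracy` p794051).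
Theorems only; no definition, axiom, `sorry`, instance or notation; ROUTE-INDEPENDENT imports (no `Theses` module in the
cone). HONEST FRAMING: bookkeeping, not progress on the crux; item 19140 is research-open and NOT closed here; BSD is
proved for no curve by this file.

The item's cell is {globally minimal, CM, `CMSplit W 2`, NOT good at `2`, `r_an = 1`}, i.e. `j ∈ {−3375, 16581375}`
(`BurungaleCastellaSkinnerTian2022.cmFieldDiscrOfJ_eq_of_cmSplit_two` + `X12.j_eq_of_cmFieldDiscrOfJ_eq_neg_seven`). `TwinAdditiveReduction` reduces the ITEM to `j = −3375` by Cassels' isogeny invariance of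
`BSD(·,2)` (`bsdTwoCMSevenAdditiveRankOne_iff_j_neg3375`); `TwinGordPlacement` transports the typed HALVES
`MissingUpper/LowerBoundAt W 2` of the `j = −3375` cell to the auxiliary quadratic fields; `TwinHeegnerHalvesPlacement`
identifies the line's half-stubs (with binders) with the typed halves on the ITEM's cell. Missing link, supplied
here: each typed HALF is itself a `ℚ`-isogeny invariant (tree: `X12.missingUpperBoundAt_of_isIsogenous`,
`X12.missingLowerBoundAt_of_isIsogenous` — Cassels: `#Ш_an/#Ш` is constant on an isogeny class), so

* §1 `upperHalf_cmSplit_additive_iff_j_neg3375`, `lowerHalf_cmSplit_additive_iff_j_neg3375` (granted Cassels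
  `bsdRHS_eq_of_isIsogenous`, GZK, analytic continuation): the typed upper (resp. lower) half on the item's cell ⟺ the
  same on the `j = −3375` cell — the minimal models of the additive-at-`2` twists `49a1^{(d)}`, `d ≢ 1 (mod 4)`.
* §2 `heegnerIndexUpperAtTwo_of_upperHalf_j_neg3375`, `heegnerIndexLowerAtTwo_of_lowerHalf_j_neg3375`: composed with
  the placement, the body of `stub_heegnerIndexUpperAtTwo` (resp. `…Lower…`) follows from the typed half on the
  `j = −3375` cell, granted the five binders of `P2.bsdp_two_iff_cmHeegnerIndex` and Cassels. So the cleanest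
  sufficient target for either half-stub is ONE one-sided statement about minimal models with `j = −3375`, additive
  at `2`, of analytic rank `1` — in Miller's currency over `ℚ`, or (via `TwinGordPlacement`) over the auxiliary field.

References: J. W. S. Cassels, J. reine angew. Math. 217 (1965) [Cassels1965]; J. S. Milne, *Arithmetic Duality Theorems*
(2006) Thm. I.7.3, Rem. I.7.4 [MilneADT2006]; R. L. Miller, LMS J. Comput. Math. 14 (2011) §1, Def. 1.1 [Miller2011LMS];
J. H. Silverman, *Advanced Topics* (1994) App. A §3 [SilvermanATAEC1994].
-/

noncomputable section

open scoped Classical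

open WeierstrassCurve NumberField Literature.NumberTheory.EllipticCurves
  Literature.NumberTheory.EllipticCurves.ModularForms
  Literature.NumberTheory.EllipticCurves.Rank1Residual
  Literature.NumberTheory.EllipticCurves.Rank1Residual.Typed

namespace Summit.BirchSwinnertonDyer.BirchSwinnertonDyer.Theorems.GoldfeldGoodTwists

open Summit.BirchSwinnertonDyer.Rank1Residual Summit.BirchSwinnertonDyer.Rank1Residual.P2

/-! ## §1 The typed halves on the item's cell ⟺ on the `j = −3375` cell -/

/-- **The Euler-system half on the item's cell ⟺ on the `j = −3375` cell** (granted Cassels `hCassels`, GZK `hGZK`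
for the finiteness of `Ш` in analytic rank `1`, analytic continuation `hmod` for `L′ ≠ 0`): forward by
`hasCM_of_j_eq_neg3375` / `cmSplit_two_of_j_eq_neg3375`; backward, a curve with `CMSplit W 2` has
`j ∈ {−3375, 16581375}` and is `ℚ`-isogenous to a globally minimal `W′` with `j = −3375`
(`exists_isGloballyMinimal_isIsogenous_j_eq_neg3375`), good reduction at `2` and `r_an` are isogeny invariants, and
the half transports back (`X12.missingUpperBoundAt_of_isIsogenous`). [cite: MilneADT2006, Thm. I.7.3 and Remark I.7.4]
[cite: Miller2011LMS, §1 and Def. 1.1] [cite: SilvermanATAEC1994, App. A §3] -/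
theorem upperHalf_cmSplit_additive_iff_j_neg3375 (hCassels : bsdRHS_eq_of_isIsogenous)
    (hGZK : rank_eq_analyticRank_of_analyticRank_le_one) (hmod : hasEntireLFunction_rat) :
    (∀ (W : WeierstrassCurve ℚ) [W.IsElliptic] [W.IsGloballyMinimal], W.HasCM → CMSplit W 2 →
      ¬ W.HasGoodReductionAtPrime 2 → W.analyticRank = 1 → MissingUpperBoundAt W 2) ↔
    ∀ (W : WeierstrassCurve ℚ) [W.IsElliptic] [W.IsGloballyMinimal],
      W.j = -3375 → ¬ W.HasGoodReductionAtPrime 2 → W.analyticRank = 1 → MissingUpperBoundAt W 2 := by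
  refine ⟨fun h W _ _ hj hg har =>
      h W (hasCM_of_j_eq_neg3375 W hj) (cmSplit_two_of_j_eq_neg3375 W hj) hg har,
    fun h W _ _ _ hsplit hg har => ?_⟩
  obtain ⟨W', hE', hmin', hiso, hj'⟩ :=
    exists_isGloballyMinimal_isIsogenous_j_eq_neg3375 W
      (X12.j_eq_of_cmFieldDiscrOfJ_eq_neg_seven
        (BurungaleCastellaSkinnerTian2022.cmFieldDiscrOfJ_eq_of_cmSplit_two W hsplit))
  haveI : Fact (Nat.Prime 2) := ⟨Nat.prime_two⟩
  have hg' : ¬ W'.HasGoodReductionAtPrime 2 := fun h' => hg ((hiso.hasGoodReductionAtPrime_iff 2).mpr h')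
  have har' : W'.analyticRank = 1 := by rw [← analyticRank_eq_of_isIsogenous' hiso]; exact har
  obtain ⟨-, hfin'⟩ := hGZK W' (by rw [har'])
  exact X12.missingUpperBoundAt_of_isIsogenous hCassels hiso hfin'
    (WeierstrassCurve.leadingLCoeff_ne_zero_holds (hmod W')) (h W' hj' hg' har')

/-- **The main-conjecture half on the item's cell ⟺ on the `j = −3375` cell** (same facts, same proof with
`X12.missingLowerBoundAt_of_isIsogenous`). [cite: MilneADT2006, Thm. I.7.3 and Remark I.7.4]
[cite: Miller2011LMS, §1 and Def. 1.1] [cite: SilvermanATAEC1994, App. A §3] -/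
theorem lowerHalf_cmSplit_additive_iff_j_neg3375 (hCassels : bsdRHS_eq_of_isIsogenous)
    (hGZK : rank_eq_analyticRank_of_analyticRank_le_one) (hmod : hasEntireLFunction_rat) :
    (∀ (W : WeierstrassCurve ℚ) [W.IsElliptic] [W.IsGloballyMinimal], W.HasCM → CMSplit W 2 →
      ¬ W.HasGoodReductionAtPrime 2 → W.analyticRank = 1 → MissingLowerBoundAt W 2) ↔
    ∀ (W : WeierstrassCurve ℚ) [W.IsElliptic] [W.IsGloballyMinimal],
      W.j = -3375 → ¬ W.HasGoodReductionAtPrime 2 → W.analyticRank = 1 → MissingLowerBoundAt W 2 := by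
  refine ⟨fun h W _ _ hj hg har =>
      h W (hasCM_of_j_eq_neg3375 W hj) (cmSplit_two_of_j_eq_neg3375 W hj) hg har,
    fun h W _ _ _ hsplit hg har => ?_⟩
  obtain ⟨W', hE', hmin', hiso, hj'⟩ :=
    exists_isGloballyMinimal_isIsogenous_j_eq_neg3375 W
      (X12.j_eq_of_cmFieldDiscrOfJ_eq_neg_seven
        (BurungaleCastellaSkinnerTian2022.cmFieldDiscrOfJ_eq_of_cmSplit_two W hsplit))
  haveI : Fact (Nat.Prime 2) := ⟨Nat.prime_two⟩
  have hg' : ¬ W'.HasGoodReductionAtPrime 2 := fun h' => hg ((hiso.hasGoodReductionAtPrime_iff 2).mpr h')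
  have har' : W'.analyticRank = 1 := by rw [← analyticRank_eq_of_isIsogenous' hiso]; exact har
  obtain ⟨-, hfin'⟩ := hGZK W' (by rw [har'])
  exact X12.missingLowerBoundAt_of_isIsogenous hCassels hiso hfin'
    (WeierstrassCurve.leadingLCoeff_ne_zero_holds (hmod W')) (h W' hj' hg' har')

/-! ## §2 The half-stubs from the typed halves on the `j = −3375` cell -/

/-- **The body of `stub_heegnerIndexUpperAtTwo` from the typed Euler-system half on the `j = −3375` cell** (granted
the five binders of `P2.bsdp_two_iff_cmHeegnerIndex` and Cassels): §1, then `P2.missingHalves_two_iff_cmHeegnerIndex` with the halvability bit pinned (as in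
`heegnerIndexUpperAtTwo_of_missingUpperBoundAt` of the placement file).
[cite: Miller2011LMS, §1 and Def. 1.1] [cite: MilneADT2006, Thm. I.7.3] -/
theorem heegnerIndexUpperAtTwo_of_upperHalf_j_neg3375 (hCassels : bsdRHS_eq_of_isIsogenous)
    (hGZ : ∀ (N : ℕ) [NeZero N] (W : WeierstrassCurve ℚ) (K : Type) [Field K] [NumberField K],
      gross_zagier N W K)
    (hKo : ∀ (N : ℕ) [NeZero N] (W : WeierstrassCurve ℚ) (K : Type) [Field K] [NumberField K],
      kolyvagin N W K)
    (hGZK : rank_eq_analyticRank_of_analyticRank_le_one) (hmod : hasEntireLFunction_rat)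
    (hBF : bsdTriple_of_hasCM_of_L_one_ne_zero)
    (hU : ∀ (W : WeierstrassCurve ℚ) [W.IsElliptic] [W.IsGloballyMinimal],
      W.j = -3375 → ¬ W.HasGoodReductionAtPrime 2 → W.analyticRank = 1 → MissingUpperBoundAt W 2) :
    ∀ (W : WeierstrassCurve ℚ) [W.IsElliptic] [W.IsGloballyMinimal] (N : ℕ) [NeZero N] (K : Type) [Field K]
      [NumberField K] (Dt : ModularParametrizationData W N) (H : HeegnerDatum N (NumberField.discr K))
      (ι : K →+* ℂ) (P : (W.baseChange K).toAffine.Point) (Wd : WeierstrassCurve ℚ) [Wd.IsElliptic]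
      [Wd.IsGloballyMinimal] (Cd : VariableChange ℚ) (k : ℕ), W.HasCM → CMSplit W 2 →
      ¬ W.HasGoodReductionAtPrime 2 → W.analyticRank = 1 → IsImaginaryQuadratic K →
      SatisfiesHeegnerHypothesis N K →
      WeierstrassCurve.Affine.Point.map ι.toRatAlgHom P = heegnerPointComplex Dt H →
      (W.quadraticTwist (NumberField.discr K : ℚ)).entireLFunction 1 ≠ 0 →
      Cd • W.quadraticTwist (NumberField.discr K : ℚ) = Wd → (k = 1 ∨ k = 2) →
      (k = 2 ↔ ∀ y : W.toAffine.Point, ∃ Q : (W.baseChange K).toAffine.Point,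
        QuadraticDescent.incl K W y - (2 : ℤ) • Q ∈ AddCommGroup.torsion (W.baseChange K).toAffine.Point) →
      (padicValNat 2 (Nat.card W.sha) : ℤ) ≤ padicValRat 2 (cmHeegnerIndexQuotient W K P Dt.c k Wd Cd.u) := by
  have hU' := (upperHalf_cmSplit_additive_iff_j_neg3375 hCassels hGZK hmod).mpr hU
  intro W _ _ N _ K _ _ Dt H ι P Wd _ _ Cd k hcm hsplit hbad hr hK hHN hP hLt hWd hk12 hkiff
  obtain ⟨k', hk12', hkiff', -, hup⟩ := missingHalves_two_iff_cmHeegnerIndex W N K Dt H ι P (hGZ N W K)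
    (hKo N W K) hGZK hmod hBF hcm hK hHN hP hr hLt Wd Cd hWd
  -- the halvability bit pins `k`: `k = k'`
  have hkk : k = k' := by
    rcases hk12 with rfl | rfl <;> rcases hk12' with rfl | rfl
    · rfl
    · exact absurd (hkiff.mpr (hkiff'.mp rfl)) (by decide)
    · exact absurd (hkiff'.mpr (hkiff.mp rfl)) (by decide)
    · rfl
  subst hkk
  exact hup.mp (hU' W hcm hsplit hbad hr)

/-- **The body of `stub_heegnerIndexLowerAtTwo` from the typed main-conjecture half on the `j = −3375` cell**
(same binders and Cassels): §1, then `P2.missingHalves_two_iff_cmHeegnerIndex` with the bit pinned. [cite: Miller2011LMS, §1 and Def. 1.1]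
[cite: MilneADT2006, Thm. I.7.3] -/
theorem heegnerIndexLowerAtTwo_of_lowerHalf_j_neg3375 (hCassels : bsdRHS_eq_of_isIsogenous)
    (hGZ : ∀ (N : ℕ) [NeZero N] (W : WeierstrassCurve ℚ) (K : Type) [Field K] [NumberField K],
      gross_zagier N W K)
    (hKo : ∀ (N : ℕ) [NeZero N] (W : WeierstrassCurve ℚ) (K : Type) [Field K] [NumberField K],
      kolyvagin N W K)
    (hGZK : rank_eq_analyticRank_of_analyticRank_le_one) (hmod : hasEntireLFunction_rat)
    (hBF : bsdTriple_of_hasCM_of_L_one_ne_zero)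
    (hL : ∀ (W : WeierstrassCurve ℚ) [W.IsElliptic] [W.IsGloballyMinimal],
      W.j = -3375 → ¬ W.HasGoodReductionAtPrime 2 → W.analyticRank = 1 → MissingLowerBoundAt W 2) :
    ∀ (W : WeierstrassCurve ℚ) [W.IsElliptic] [W.IsGloballyMinimal] (N : ℕ) [NeZero N] (K : Type) [Field K]
      [NumberField K] (Dt : ModularParametrizationData W N) (H : HeegnerDatum N (NumberField.discr K))
      (ι : K →+* ℂ) (P : (W.baseChange K).toAffine.Point) (Wd : WeierstrassCurve ℚ) [Wd.IsElliptic]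
      [Wd.IsGloballyMinimal] (Cd : VariableChange ℚ) (k : ℕ), W.HasCM → CMSplit W 2 →
      ¬ W.HasGoodReductionAtPrime 2 → W.analyticRank = 1 → IsImaginaryQuadratic K →
      SatisfiesHeegnerHypothesis N K →
      WeierstrassCurve.Affine.Point.map ι.toRatAlgHom P = heegnerPointComplex Dt H →
      (W.quadraticTwist (NumberField.discr K : ℚ)).entireLFunction 1 ≠ 0 →
      Cd • W.quadraticTwist (NumberField.discr K : ℚ) = Wd → (k = 1 ∨ k = 2) →
      (k = 2 ↔ ∀ y : W.toAffine.Point, ∃ Q : (W.baseChange K).toAffine.Point,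
        QuadraticDescent.incl K W y - (2 : ℤ) • Q ∈ AddCommGroup.torsion (W.baseChange K).toAffine.Point) →
      padicValRat 2 (cmHeegnerIndexQuotient W K P Dt.c k Wd Cd.u) ≤ padicValNat 2 (Nat.card W.sha) := by
  have hL' := (lowerHalf_cmSplit_additive_iff_j_neg3375 hCassels hGZK hmod).mpr hL
  intro W _ _ N _ K _ _ Dt H ι P Wd _ _ Cd k hcm hsplit hbad hr hK hHN hP hLt hWd hk12 hkiff
  obtain ⟨k', hk12', hkiff', hlow, -⟩ := missingHalves_two_iff_cmHeegnerIndex W N K Dt H ι P (hGZ N W K)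
    (hKo N W K) hGZK hmod hBF hcm hK hHN hP hr hLt Wd Cd hWd
  -- the halvability bit pins `k`: `k = k'`
  have hkk : k = k' := by
    rcases hk12 with rfl | rfl <;> rcases hk12' with rfl | rfl
    · rfl
    · exact absurd (hkiff.mpr (hkiff'.mp rfl)) (by decide)
    · exact absurd (hkiff'.mpr (hkiff.mp rfl)) (by decide)
    · rfl
  subst hkk
  exact hlow.mp (hL' W hcm hsplit hbad hr)

end Summit.BirchSwinnertonDyer.BirchSwinnertonDyer.Theorems.GoldfeldGoodTwists

end
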